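import Literature.MathematicalPhysics.QuantumFieldTheory.Balaban1983to89.B6OpTransposeV1
import Literature.MathematicalPhysics.QuantumFieldTheory.Balaban1983to89.B6Eq291Transpose

/-!
# `Balaban1983to89.B6KFamTransposeKLevelV1` — T. Bałaban, *Propagators and renormalization transformations for lattice gauge theories. II*,
# Commun. Math. Phys. **96** (1984) 223–250 [Balaban1984PropagatorsII], (2.91)–(2.93) p. 239 and (2.134), (2.141) p. 247: THE TRANSPOSE OF THE
# (2.91) KERNEL FAMILY IS p38's REVERSED FAMILY — `(K_{□,□′}G_{□′}h_{□′})ᵀ = h_{□′}G_{□′}K̃_{□,□′}` for the GENUINE k-level cubes of the V1 torus, because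
# `∂(1−R)∂*`, `M_□`, `P_□`, `G_□` are `ℓ²`-symmetric and `h_□`, `ζ_□` are multiplication operators (file 13 of the block-`ℓ²` bricks: it converts the sup
# majorants of the reversed family — `…B6Ineq2134TransposeKLevelTorus`, `B6Prop26MirrorAssemblyV1` — into the `tr (…)` input of
# `…B6RandomWalkL2Prop26Grad2KLevelV1`, i.e. the second (2.134) family the `L²` entries (2.140)₄₋₆ need)

statement-level skeleton of published theorems with citation tags; proofs where landed; nothing here is a claim about the Yang–Mills mass gap

WHAT IS PRINTED (p. 239 [PDF 17]): *"Δ_aG₀ = I − Σ_{□,□′} K_{□,□′}G_{□′}h_{□′} = I − R (2.91), where K_{□,□} = [(Δ + Q*aQ)h_□ − h_□(Δ + Q*aQ)] + ζ_□(∂P∂* − ∂P_□∂*)h_□ +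
ζ_□(∂P_□∂*h_□ − h_□∂P_□∂*) (2.92), K_{□,□′} = h_□²(1 − ζ_□)∂P∂*h_{□′} (2.93)"*; p. 247 [PDF 25]: (2.134) and *"(2.141) … convergent in the norms appearing in
(2.136)–(2.140)"*.  Print states (2.91) only in the left form; the reversed family is p38's bookkeeping for the right-factor entries (`…B6Eq291Transpose`),
derived there WITHOUT symmetry; THIS FILE records that for the genuine (symmetric) V1 operators it IS the transpose.

CITATION HEADER (lean-in-tree rule) — WHAT IS REPRODUCED.  Phase-2 file of the `lit-balaban` typed skeleton (HOME `run/shared/lean/pub/lit-balaban/`), seat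
**p22 gen 30** (free-target protocol G.5-34(d), TAKING HOME/STATUS 2026-08-24T13:26Z «block-ℓ² walk toward census (2.140)₄₋₆», cc r03/p38); SKELETON rows
**B6.Eq2.91** × B6.Eq2.92 × B6.Eq2.93 × B6.Eq2.134 × B6.Prop2.6 (cells only; decls of record — p02's `kFam/kDiag/kOff`, p38's `kFamT/kDiagT/kOffT`, `tr` —
untouched).  IMPORTS BY NAME: p38's `…B6OpTransposeV1` (`tr`, `tr_mul/add/sub/one/mulOp`, `tr_onFun_of_symm`, **`tr_Gl`/`tr_Ml`/`tr_Pl`** — *"every V1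
operator is symmetric"*), `…B6Eq291Transpose` (`kFamT`, `kDiagT`, `kOffT`), `…B6SectAOperatorsV1` (`inner_dE_left`, `inner_dsE_left`, `inner_RE_left`:
`∂* = ∂†`, `R` an orthogonal projection):
* §1 (generic, any finite `X`) **`tr_kDiag`**, **`tr_kOff`**, **`tr_kFam`** — with `h_□·`, `ζ_□·` multiplication operators and `tr ∂P∂* = ∂P∂*`, `tr M_□ = M_□`,
  `tr P_□ = P_□`: `tr (K_{□,□′}) = K̃_{□,□′}` (each product reversed), and **`tr_kFam_mul`**: `tr (K_{□,□′}·G_{□′}·h_{□′}) = h_{□′}·G_{□′}·K̃_{□,□′}` given also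
  `tr G_□ = G_□`;
* §2 (the V1 torus) **`tr_onFun_Dg`** — `∂(1−R)∂*` is symmetric (`∂*` the adjoint of `∂`, `1 − R` self-adjoint); **`tr_kFam_Gl_hB`** — for the genuine cube
  family (`Gl`, `Ml`, `Pl`, `hB`, `zB`, `Dg = onFun (dE c′ ∘ (1 − RE) ∘ dsE c′)`): `tr ((K_{□,□′}·G_{□′})·h_{□′}) = h_{□′}·G_{□′}·K̃_{□,□′}`;
* §3 **`hasMajorant_tr_kFam_of_reversed`** — a block sup-majorant of p38's reversed product `h_{□′}G_{□′}K̃_{□,□′}` IS one of `tr ((K_{□,□′}G_{□′})h_{□′})` (the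
  displayed input `h2134T` of `…B6RandomWalkL2Prop26Grad2KLevelV1.prop26_2140_grad2_kLevel_skeleton` / `_of_2134T`).
THEOREMS ONLY (no definition, no `def … : Prop`, no new hypothesis); standard axioms.

HONEST SCOPE / DIVERGENCES.  (1) Pure operator algebra on the finite V1 torus; the symmetry inputs are the tree's (`tr_Gl`, `tr_Ml`, `tr_Pl` need the member
band `a₀ > 0` and the placement, as in p38's file).  (2) Print needs no transposes (it never leaves the sup norms except in (2.140), where it only asserts
convergence); the reversed family and this identification are OUR bookkeeping for the `L²` walk.  Nothing on d = 4 or the continuum; NOT summit progress.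
Unit `lit-balaban-p22` (gen 30), 2026-08-24.
-/

noncomputable section

open scoped BigOperators InnerProductSpace
open Finset

namespace Literature.MathematicalPhysics.QuantumFieldTheory.Balaban1983to89.B6KFamTransposeKLevelV1

open B6Prop26Gluing (mulOp)
open B6RandomWalk (HasMajorant)
open B6OpTransposeV1 (tr tr_mul tr_add tr_sub tr_one tr_mulOp tr_onFun_of_symm tr_Gl tr_Ml tr_Pl)
open B6Eq291Generator (kFam kDiag kOff)
open B6Eq291Transpose (kFamT kDiagT kOffT)
open B6Ineq2133TwoScaleV1 (onFun)
open B6MultiLevelBoxOperator (N0)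
open B6MultiLevelTorusOperator (TDomains)
open B6Cover236MultiLevelBlocks (cubes)
open B6Geom246MultiLevelTorus (geomT)
open B6GlobalChartV1 (PV domT blkV1)
open B6SectAOperatorsV1 (dE dsE RE BondIdx inner_dE_left inner_dsE_left inner_RE_left)
open B6Prop26KLevelSkeletonV1 (hB zB)
open B6CubeWindowV1 (Placed Gl Ml Pl)

/-! ## §1  Generic: the transpose of the (2.91) kernels -/

section Generic

variable {X : Type} [Fintype X] [DecidableEq X]

/-- **`tr K_{□,□} = K̃_{□,□}`** ((2.92) transposed, each product reversed) when `h·`, `ζ·` are multiplication operators and `∂P∂*`, `M_□`, `P_□` are symmetric.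
[cite: Balaban1984PropagatorsII, (2.92) p.239] -/
theorem tr_kDiag {Dg Mo Po : Module.End ℝ (X → ℝ)} (h z : X → ℝ) (hDg : tr Dg = Dg) (hM : tr Mo = Mo) (hP : tr Po = Po) :
    tr (kDiag Dg (mulOp h) (mulOp z) Mo Po) = kDiagT Dg (mulOp h) (mulOp z) Mo Po := by
  unfold kDiag kDiagT
  simp only [tr_add, tr_sub, tr_mul, tr_mulOp, hDg, hM, hP, mul_assoc]

/-- **`tr K_{□,□′} = K̃_{□,□′}`** ((2.93) transposed). [cite: Balaban1984PropagatorsII, (2.93) p.239] -/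
theorem tr_kOff {Dg : Module.End ℝ (X → ℝ)} (hi zj hj : X → ℝ) (hDg : tr Dg = Dg) :
    tr (kOff Dg (mulOp hi) (mulOp zj) (mulOp hj)) = kOffT Dg (mulOp hi) (mulOp zj) (mulOp hj) := by
  unfold kOff kOffT
  simp only [tr_sub, tr_mul, tr_mulOp, tr_one, hDg, mul_assoc]

/-- **`tr K_{□,□′} = K̃_{□,□′}` FOR THE WHOLE FAMILY** (2.91)–(2.93). [cite: Balaban1984PropagatorsII, (2.91)–(2.93) p.239] -/
theorem tr_kFam {ι : Type} [DecidableEq ι] {Dg : Module.End ℝ (X → ℝ)} (h z : ι → X → ℝ) {Mo Po : ι → Module.End ℝ (X → ℝ)}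
    (hDg : tr Dg = Dg) (hM : ∀ i, tr (Mo i) = Mo i) (hP : ∀ i, tr (Po i) = Po i) (i j : ι) :
    tr (kFam Dg (fun i => mulOp (h i)) (fun i => mulOp (z i)) Mo Po i j) = kFamT Dg (fun i => mulOp (h i)) (fun i => mulOp (z i)) Mo Po i j := by
  unfold kFam kFamT
  split_ifs
  · exact tr_kDiag (h j) (z j) hDg (hM j) (hP j)
  · exact tr_kOff (h i) (z j) (h j) hDg

/-- **`tr ((K_{□,□′}·G_{□′})·h_{□′}) = h_{□′}·G_{□′}·K̃_{□,□′}`** — the transpose of a (2.91) pair product is p38's reversed pair product.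
[cite: Balaban1984PropagatorsII, (2.91) p.239, (2.134) p.247] -/
theorem tr_kFam_mul {ι : Type} [DecidableEq ι] {Dg : Module.End ℝ (X → ℝ)} (h z : ι → X → ℝ) {Mo Po G : ι → Module.End ℝ (X → ℝ)}
    (hDg : tr Dg = Dg) (hM : ∀ i, tr (Mo i) = Mo i) (hP : ∀ i, tr (Po i) = Po i) (hG : ∀ i, tr (G i) = G i) (i j : ι) :
    tr ((kFam Dg (fun i => mulOp (h i)) (fun i => mulOp (z i)) Mo Po i j * G j) * mulOp (h j)) =
      mulOp (h j) * G j * kFamT Dg (fun i => mulOp (h i)) (fun i => mulOp (z i)) Mo Po i j := by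
  rw [tr_mul, tr_mul, tr_mulOp, hG j, tr_kFam h z hDg hM hP i j, mul_assoc]

end Generic

/-! ## §2  The genuine V1 family: `∂(1−R)∂*` is symmetric, hence `tr (K·G·h) = h·G·K̃` -/

section V1

/-- **`∂(1−R)∂*` IS SYMMETRIC** on the V1 model: `∂*` is the adjoint of `∂` (`inner_dE_left`/`inner_dsE_left`) and `R` is an orthogonal projection
(`inner_RE_left`). [cite: Balaban1984PropagatorsII, (2.8) p.224, (2.17) p.225, (2.92) p.239] -/
theorem tr_onFun_Dg {Pm : Params} (Dm : B6SectADomainsV1.Domains Pm) (cf : ℝ) :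
    tr (onFun (dE (P := Pm) cf ∘ₗ (LinearMap.id - RE Dm cf) ∘ₗ dsE cf)) = onFun (dE (P := Pm) cf ∘ₗ (LinearMap.id - RE Dm cf) ∘ₗ dsE cf) := by
  refine tr_onFun_of_symm fun u v => ?_
  simp only [LinearMap.coe_comp, Function.comp_apply, LinearMap.sub_apply, LinearMap.id_apply, map_sub, inner_sub_left, inner_sub_right]
  rw [inner_dE_left, inner_dE_left, inner_RE_left, inner_dsE_left, inner_dsE_left]

variable {d ℓ : ℕ} {hd : 1 ≤ d + 1} {hL : Odd (ℓ + 1) ∧ 1 < ℓ + 1} {a₀ a₁ : ℝ} {m K : ℕ} {Mh k R : ℕ} {P' : Fin (d + 1) → ℕ}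
variable (hN : ∀ μ, N0 ℓ Mh k P' μ = (PV d ℓ m K hd hL).sitesPerDir 0) {D : TDomains d ℓ Mh k P' R} (hk : k ≤ m + K)
  (hMh1 : 1 ≤ Mh) (hP4 : ∀ μ, 4 ≤ P' μ) {a : ℕ} (hMha : Mh = (ℓ + 1) ^ a) (ha : a₀ ≤ a₁)

/-- **`tr ((K_{□,□′}·G_{□′})·h_{□′}) = h_{□′}·G_{□′}·K̃_{□,□′}` FOR THE GENUINE k-LEVEL CUBES** (`Gl`, `Ml`, `Pl`, `hB`, `zB` of ROUTE V, `Dg = ∂(1−R)∂*`):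
the (2.134) operators' transposes are p38's reversed products. [cite: Balaban1984PropagatorsII, (2.91)–(2.93) p.239, (2.134) p.247] -/
theorem tr_kFam_Gl_hB (ha₀ : 0 < a₀) (hpl : ∀ c : ↥(cubes D.toDomains), Placed ℓ k P' c.1) (w : BondIdx (domT hN D hk) → ℝ) (cf : ℝ)
    (c c' : ↥(cubes D.toDomains)) :
    tr ((kFam (onFun (dE (P := PV d ℓ m K hd hL) cf ∘ₗ (LinearMap.id - RE (domT hN D hk) cf) ∘ₗ dsE cf))
          (fun c => mulOp (hB hN D c)) (fun c => mulOp (zB hN D hMh1 hP4 c))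
          (fun c => Ml hN hk hMh1 hP4 hMha c ha (hpl c) w cf) (fun c => Pl hN hk hMh1 hP4 hMha c ha (hpl c) w cf) c c' *
        Gl hN hk hMh1 hP4 hMha c' ha (hpl c') w cf) * mulOp (hB hN D c')) =
      mulOp (hB hN D c') * Gl hN hk hMh1 hP4 hMha c' ha (hpl c') w cf *
        kFamT (onFun (dE (P := PV d ℓ m K hd hL) cf ∘ₗ (LinearMap.id - RE (domT hN D hk) cf) ∘ₗ dsE cf))
          (fun c => mulOp (hB hN D c)) (fun c => mulOp (zB hN D hMh1 hP4 c))
          (fun c => Ml hN hk hMh1 hP4 hMha c ha (hpl c) w cf) (fun c => Pl hN hk hMh1 hP4 hMha c ha (hpl c) w cf) c c' :=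
  tr_kFam_mul (fun c => hB hN D c) (fun c => zB hN D hMh1 hP4 c) (tr_onFun_Dg (domT hN D hk) cf)
    (fun c => tr_Ml hN hk hMh1 hP4 hMha c ha ha₀ (hpl c) w cf) (fun c => tr_Pl hN hk hMh1 hP4 hMha c ha ha₀ (hpl c) w cf)
    (fun c => tr_Gl hN hk hMh1 hP4 hMha c ha ha₀ (hpl c) w cf) c c'

/-! ## §3  The displayed `tr`-input of the `L²` assembly from a majorant of the reversed product -/

/-- **A SUP MAJORANT OF p38's REVERSED PRODUCT `h_{□′}G_{□′}K̃_{□,□′}` IS ONE OF `tr ((K_{□,□′}G_{□′})h_{□′})`** — the shape of the displayed input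
`h2134T` of `…B6RandomWalkL2Prop26Grad2KLevelV1.prop26_2140_grad2_kLevel_skeleton` / `_of_2134T`.
[cite: Balaban1984PropagatorsII, (2.134) p.247, (2.91) p.239] -/
theorem hasMajorant_tr_kFam_of_reversed (ha₀ : 0 < a₀) (hpl : ∀ c : ↥(cubes D.toDomains), Placed ℓ k P' c.1)
    (w : BondIdx (domT hN D hk) → ℝ) (cf : ℝ) {Kk : (geomT D).Site → (geomT D).Site → ℝ} (c c' : ↥(cubes D.toDomains))
    (h : HasMajorant (g := geomT D) (blkV1 hN D)
      (mulOp (hB hN D c') * Gl hN hk hMh1 hP4 hMha c' ha (hpl c') w cf *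
        kFamT (onFun (dE (P := PV d ℓ m K hd hL) cf ∘ₗ (LinearMap.id - RE (domT hN D hk) cf) ∘ₗ dsE cf))
          (fun c => mulOp (hB hN D c)) (fun c => mulOp (zB hN D hMh1 hP4 c))
          (fun c => Ml hN hk hMh1 hP4 hMha c ha (hpl c) w cf) (fun c => Pl hN hk hMh1 hP4 hMha c ha (hpl c) w cf) c c') Kk) :
    HasMajorant (g := geomT D) (blkV1 hN D)
      (tr ((kFam (onFun (dE (P := PV d ℓ m K hd hL) cf ∘ₗ (LinearMap.id - RE (domT hN D hk) cf) ∘ₗ dsE cf))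
            (fun c => mulOp (hB hN D c)) (fun c => mulOp (zB hN D hMh1 hP4 c))
            (fun c => Ml hN hk hMh1 hP4 hMha c ha (hpl c) w cf) (fun c => Pl hN hk hMh1 hP4 hMha c ha (hpl c) w cf) c c' *
          Gl hN hk hMh1 hP4 hMha c' ha (hpl c') w cf) * mulOp (hB hN D c'))) Kk := by
  rw [tr_kFam_Gl_hB hN hk hMh1 hP4 hMha ha ha₀ hpl w cf c c']
  exact h

end V1

end Literature.MathematicalPhysics.QuantumFieldTheory.Balaban1983to89.B6KFamTransposeKLevelV1

end
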